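import Literature.NumberTheory.Weil1965.LocalQuadraticGaussTransformDecayMax
import Literature.NumberTheory.Weil1965.LocalQuadraticGaussUnramified
import Literature.NumberTheory.Automorphic.FiniteAdelePureTensorIntegral
import Literature.NumberTheory.Automorphic.AdeleAddCharProductFormula
import Literature.NumberTheory.Automorphic.GlobalAdditiveCharacterProofs
import Literature.NumberTheory.Automorphic.AdeleAddCharLocalComponentsUnramified
import HarnessLib

/-!
# Decay of the finite-adelic Gauss transform `∫ Φ_f(b) ψ_f(η Σ dᵢ bᵢ²) db ≪ ∏_v max(1, |η_v|_v)^{-r/2}`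

Topic `NumberTheory/Weil1965`; namespace `Literature.NumberTheory.Weil1965`.  KERNEL mathematics only (theorems; no
definition, no named fact, no `axiom`, no `sorry`).

For a number field `K`, a finite index type `ι` (`r = |ι|`), non-zero RATIONAL coefficients `dᵢ ∈ K^×`, Tate's character
`ψ_f = ∏_v ψ_v` on `𝔸_{K,f}` (★ `finiteAdeleAddChar`, ★ `map_zero_prod_eq_finprod_adicComponent`), a Haar measure `μ` on
`(𝔸_{K,f})^ι` and a Schwartz–Bruhat function `Φ` on `(𝔸_{K,f})^ι` (locally constant, compact support), the FINITE-ADELIC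
GAUSS TRANSFORM of the diagonal form `q(b) = Σ dᵢ bᵢ²` satisfies, for EVERY finite adele `η`,

  `‖∫ Φ(b) ψ_f(η q(b)) dμ(b)‖ ≤ C(Φ) · (∏_v max(1, |η_v|_v))^{-r/2}`   (`exists_norm_integral_mul_finiteAdeleAddChar_sum_sq_le`),

the finite half of the Euler-product majorant of [Weil1965, Chap. I n° 2 Prop. 2; n° 40 Thm. 1 (p. 57), condition (B)].  Road
(Tate's Theorem 3.3.1): pure tensors `Φ = ∏_v Φ_v` span (★ `mem_span_range_piProd`); for a FIXED `η` the integrand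
`Φ(b) ψ_f(η q(b))` is the indicator of the integrality box off a finite set `T_η` times a finite product of CONTINUOUS local
factors `Φ_v(z) ψ_v(η_v q(z))`, so ★ `integral_indicator_offBox_prod_eq` factors the integral over the places; at the finitely
many bad places `T₀` (where `Φ_v ≠ 𝟙_{𝒪_v^ι}`, `ψ_v` is ramified, `‖2‖_v ≠ 1` or some `dᵢ` is not a `v`-unit) Weil's local decay
★ `exists_norm_integral_mul_psiSqPi_le_max_rpow` bounds the factor by `C_v · max(1,|η_v|)^{-r/2}`; at every other place the
factor is EXACTLY `μ_v(𝒪_v)^r · max(1, |η_v|)^{-r/2}` (★ `norm_integral_indicator_piPrimePowBall_mul_psiSqPi_of_unramified`), and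
`= μ_v(𝒪_v)^r` when moreover `η_v ∈ 𝒪_v` — so only finitely many factors differ from the Haar normalisation.

Cell `hodgecm-mathlib`, FLOOR 0, crux H413 (stmt-HodgeConjecture-24833), E-2 ∕ SW2c-BOUND sheet §2 letter (E1), finite half
(sequel: `AdelicGaussTransformMajorant.lean`).  HC_CM is proved only modulo the 7 printed citations until rung 0 closes; this file
is unconditional.

## References
* [Weil1965] A. Weil, *Sur la formule de Siegel dans la théorie des groupes classiques*, Acta Math. 113 (1965): Chap. I n° 2
  Prop. 2 (p. 8); n° 40 Thm. 1 (p. 57).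
* [TateThesis1967] J. Tate, *Fourier analysis in number fields and Hecke's zeta-functions*, in Cassels–Fröhlich (1967),
  Ch. XV, Thm. 3.3.1, Lemma 3.2.1.
-/

set_option autoImplicit false

noncomputable section

open MeasureTheory Filter Topology Set NumberField IsDedekindDomain
open scoped NNReal ENNReal
open Literature.NumberTheory.GaloisRepresentations.IsNonarchimedeanLocalField
open Literature.NumberTheory.Automorphic
open Literature.NumberTheory.Weil1964

namespace Literature.NumberTheory.Weil1965

variable (K : Type) [Field K] [NumberField K] (ι : Type) [Fintype ι]
  [∀ v : HeightOneSpectrum (𝓞 K), MeasurableSpace (v.adicCompletion K)]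
  [∀ v : HeightOneSpectrum (𝓞 K), BorelSpace (v.adicCompletion K)]

/-! ## §1 The local factors at a place `v` for Tate's character `ψ_v` and rational coefficients -/

section Local

variable (v : HeightOneSpectrum (𝓞 K)) (μv : Measure (v.adicCompletion K)) [μv.IsAddHaarMeasure]

omit [∀ v : HeightOneSpectrum (𝓞 K), MeasurableSpace (v.adicCompletion K)]
  [∀ v : HeightOneSpectrum (𝓞 K), BorelSpace (v.adicCompletion K)] in
/-- the local second-degree character `z ↦ ψ_v(Σ cᵢ zᵢ²)` is continuous. [folklore] -/
private theorem continuous_psiSqPi_adic (c : ι → v.adicCompletion K) :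
    Continuous (psiSqPi ((adeleAddChar K).adicComponent v) c) := by
  have hψ : Continuous ((adeleAddChar K).adicComponent v) := (continuous_adeleAddChar K).adicComponent v
  unfold psiSqPi
  exact continuous_finsetProd _ fun i _ => (continuous_psiSq hψ (c i)).comp (continuous_apply i)

omit [∀ v : HeightOneSpectrum (𝓞 K), MeasurableSpace (v.adicCompletion K)]
  [∀ v : HeightOneSpectrum (𝓞 K), BorelSpace (v.adicCompletion K)] in
/-- a non-zero element of `K` is non-zero in `K_v`. [folklore] -/
private theorem coe_adicCompletion_ne_zero {k : K} (hk : k ≠ 0) : (k : v.adicCompletion K) ≠ 0 := by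
  rw [show (k : v.adicCompletion K) = algebraMap K (v.adicCompletion K) k from rfl]
  exact (map_ne_zero _).2 hk

/-- **BAD PLACES — Weil's local decay for Tate's `ψ_v`**: for non-zero rational `dᵢ` and a Schwartz–Bruhat `Φ_v` on `K_v^ι`
there is `C ≥ 0` with `‖∫ Φ_v(z) ψ_v(β Σ dᵢ zᵢ²) dμ_v^ι‖ ≤ C · max(1, |β|_v)^{-r/2}` for every `β ∈ K_v` (`ψ_v` has SOME conductor
exponent ★ `IsGlobalAddChar.exists_hasConductorExp_adicComponent`, `‖2‖_v = q_v^{-v₂}` for some `v₂`).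
[cite: Weil1965, Chap. I n° 2 Prop. 2, p. 8] -/
theorem exists_norm_integral_mul_psiSqPi_adic_le {d : ι → K} (hd : ∀ i, d i ≠ 0)
    {Φv : (ι → v.adicCompletion K) → ℂ} (hΦv : Φv ∈ SchwartzBruhat (ι → v.adicCompletion K)) :
    ∃ C : ℝ, 0 ≤ C ∧ ∀ β : v.adicCompletion K,
      ‖∫ z, Φv z * psiSqPi ((adeleAddChar K).adicComponent v) (fun i => β * (d i : v.adicCompletion K)) z
          ∂(Measure.pi fun _ : ι => μv)‖ ≤
        C * ((max 1 (normAbs (v.adicCompletion K) β) : ℝ≥0) : ℝ) ^ (-((Fintype.card ι : ℝ) / 2)) := by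
  obtain ⟨m, hm⟩ := (isGlobalAddChar_adeleAddChar K).exists_hasConductorExp_adicComponent v
  have h2ne : (2 : v.adicCompletion K) ≠ 0 := by
    have h := coe_adicCompletion_ne_zero K v (k := 2) two_ne_zero
    rwa [show ((2 : K) : v.adicCompletion K) = 2 from map_ofNat (algebraMap K (v.adicCompletion K)) 2] at h
  obtain ⟨v₂, hv₂⟩ := exists_normAbs_eq_inv_zpow h2ne
  exact exists_norm_integral_mul_psiSqPi_le_max_rpow μv hm hv₂ (fun i => coe_adicCompletion_ne_zero K v (hd i)) hΦv

omit [∀ v : HeightOneSpectrum (𝓞 K), MeasurableSpace (v.adicCompletion K)]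
  [∀ v : HeightOneSpectrum (𝓞 K), BorelSpace (v.adicCompletion K)] in
/-- the unit vector `𝟙_{𝒪_v^ι}` is the indicator of the zero coset `piCoset 0 0` of the local Gauss files. [folklore] -/
private theorem coe_unitVec_eq_indicator_piCoset :
    ((unitVec K ι v : ↥(SchwartzBruhat (ι → v.adicCompletion K))) : (ι → v.adicCompletion K) → ℂ) =
      (piCoset (v.adicCompletion K) (fun _ : ι => (0 : v.adicCompletion K)) 0).indicator fun _ => (1 : ℂ) := by
  rw [coe_unitVec]
  congr 1
  ext z
  rw [mem_integralBox_iff, mem_piCoset_iff]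
  refine forall_congr' fun i => ?_
  rw [sub_zero, mem_primePowBall_zero_iff]

/-- **GOOD PLACES — the exact factor**: if `ψ_v` has conductor exponent `0`, `‖2‖_v = 1` and every `dᵢ` is a `v`-unit, then
`‖∫ 𝟙_{𝒪_v^ι}(z) ψ_v(β Σ dᵢ zᵢ²) dμ_v^ι‖ = μ_v(𝒪_v)^r · max(1, |β|_v)^{-r/2}` for every `β ∈ K_v`.
[cite: Weil1965, Chap. I n° 2 Prop. 2, p. 8; n° 40 Thm. 1, p. 57] -/
theorem norm_integral_unitVec_mul_psiSqPi_adic_eq (hψ : ((adeleAddChar K).adicComponent v).HasConductorExp 0)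
    (h2 : normAbs (v.adicCompletion K) (2 : v.adicCompletion K) = 1) {d : ι → K}
    (hdv : ∀ i, normAbs (v.adicCompletion K) (d i : v.adicCompletion K) = 1) (β : v.adicCompletion K) :
    ‖∫ z, ((unitVec K ι v : ↥(SchwartzBruhat (ι → v.adicCompletion K))) : (ι → v.adicCompletion K) → ℂ) z *
        psiSqPi ((adeleAddChar K).adicComponent v) (fun i => β * (d i : v.adicCompletion K)) z
          ∂(Measure.pi fun _ : ι => μv)‖ =
      μv.real (primePowBall (v.adicCompletion K) 0) ^ Fintype.card ι *
        ((max 1 (normAbs (v.adicCompletion K) β) : ℝ≥0) : ℝ) ^ (-((Fintype.card ι : ℝ) / 2)) := by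
  rw [coe_unitVec_eq_indicator_piCoset]
  exact norm_integral_indicator_piPrimePowBall_mul_psiSqPi_of_unramified μv hψ h2 hdv β

omit [∀ v : HeightOneSpectrum (𝓞 K), BorelSpace (v.adicCompletion K)] in
/-- the product Haar measure of the integral box is `μ_v(𝒪_v)^r`. [folklore] -/
private theorem pi_integralBox_eq_pow :
    Measure.pi (fun _ : ι => μv) (integralBox K ι v) = μv (primePowBall (v.adicCompletion K) 0) ^ Fintype.card ι := by
  haveI : SecondCountableTopology (v.adicCompletion K) := secondCountableTopology_adicCompletion K v
  have hbox : integralBox K ι v = Set.pi Set.univ fun _ : ι => primePowBall (v.adicCompletion K) 0 := by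
    ext z
    simp only [mem_integralBox_iff, Set.mem_pi, Set.mem_univ, forall_const, mem_primePowBall_zero_iff]
  rw [hbox, Measure.pi_pi, Finset.prod_const, Finset.card_univ]

end Local

/-! ## §2 The good places are cofinite -/

section Cofinite

omit [∀ v : HeightOneSpectrum (𝓞 K), MeasurableSpace (v.adicCompletion K)]
  [∀ v : HeightOneSpectrum (𝓞 K), BorelSpace (v.adicCompletion K)]

/-- a non-zero `k ∈ K` is a `v`-adic unit, `‖k‖_v = 1`, for all but finitely many `v`. [folklore] -/
private theorem eventually_normAbs_coe_eq_one {k : K} (hk : k ≠ 0) :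
    ∀ᶠ v : HeightOneSpectrum (𝓞 K) in cofinite, normAbs (v.adicCompletion K) (k : v.adicCompletion K) = 1 := by
  have hfin : {v : HeightOneSpectrum (𝓞 K) | v.valuation K k ≠ 1}.Finite := by
    refine ((HeightOneSpectrum.Support.finite (𝓞 K) k).union
      (HeightOneSpectrum.Support.finite (𝓞 K) k⁻¹)).subset fun v hv => ?_
    simp only [Set.mem_setOf_eq, Set.mem_union, HeightOneSpectrum.Support, map_inv₀] at hv ⊢
    rcases hv.lt_or_gt with h | h
    · exact Or.inr ((one_lt_inv₀ ((Valuation.pos_iff _).mpr hk)).mpr h)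
    · exact Or.inl h
  filter_upwards [hfin.compl_mem_cofinite] with v hv
  have hval : v.valuation K k = WithZero.exp (0 : ℤ) := by
    rw [WithZero.exp_zero]
    simpa only [Set.mem_compl_iff, Set.mem_setOf_eq, not_not] using hv
  rw [normAbs_coe_eq_inv_zpow v hval, neg_zero, zpow_zero]

/-- **the good places are cofinite**: for all but finitely many `v`, `ψ_v` has conductor exponent `0`, `‖2‖_v = 1`, every
`dᵢ` is a `v`-unit and the local component of the pure tensor is the unit vector. [cite: TateThesis1967, Thm 3.3.1] -/
theorem eventually_good {d : ι → K} (hd : ∀ i, d i ≠ 0) (Φ : LocalSBFamily K ι) :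
    ∀ᶠ v : HeightOneSpectrum (𝓞 K) in cofinite,
      ((adeleAddChar K).adicComponent v).HasConductorExp 0 ∧
        normAbs (v.adicCompletion K) (2 : v.adicCompletion K) = 1 ∧
          (∀ i, normAbs (v.adicCompletion K) (d i : v.adicCompletion K) = 1) ∧ Φ v = unitVec K ι v := by
  have h2 : ∀ᶠ v : HeightOneSpectrum (𝓞 K) in cofinite, normAbs (v.adicCompletion K) (2 : v.adicCompletion K) = 1 := by
    filter_upwards [eventually_normAbs_coe_eq_one K (k := 2) two_ne_zero] with v hv
    rwa [show ((2 : K) : v.adicCompletion K) = 2 from map_ofNat (algebraMap K (v.adicCompletion K)) 2] at hv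
  have hd' : ∀ᶠ v : HeightOneSpectrum (𝓞 K) in cofinite, ∀ i, normAbs (v.adicCompletion K) (d i : v.adicCompletion K) = 1 :=
    eventually_all.2 fun i => eventually_normAbs_coe_eq_one K (hd i)
  exact (eventually_hasConductorExp_zero_adicComponent_adeleAddChar (K := K)).and (h2.and (hd'.and Φ.eventually_eq))

end Cofinite

/-! ## §3 The bound for a pure tensor `Φ = ∏_v Φ_v` (Tate's Theorem 3.3.1 place by place) -/

section PureTensor

omit [∀ v : HeightOneSpectrum (𝓞 K), MeasurableSpace (v.adicCompletion K)]
  [∀ v : HeightOneSpectrum (𝓞 K), BorelSpace (v.adicCompletion K)] in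
/-- the `v`-component of `η · Σ dᵢ bᵢ²` is `η_v · Σ dᵢ b_{i,v}²`. [folklore] -/
private theorem apply_mul_sum_sq (d : ι → K) (η : FiniteAdeleRing (𝓞 K) K) (b : ι → FiniteAdeleRing (𝓞 K) K)
    (v : HeightOneSpectrum (𝓞 K)) :
    (η * ∑ i, algebraMap K (FiniteAdeleRing (𝓞 K) K) (d i) * b i ^ 2) v =
      η v * ∑ i, (d i : v.adicCompletion K) * (b i v) ^ 2 := by
  let e : FiniteAdeleRing (𝓞 K) K →+* v.adicCompletion K :=
    RestrictedProduct.evalRingHom (fun w : HeightOneSpectrum (𝓞 K) => w.adicCompletion K) v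
  have he : ∀ x : FiniteAdeleRing (𝓞 K) K, e x = x v := fun x => rfl
  rw [← he, map_mul, map_sum]
  simp_rw [map_mul, map_pow, he]
  rfl

omit [∀ v : HeightOneSpectrum (𝓞 K), MeasurableSpace (v.adicCompletion K)]
  [∀ v : HeightOneSpectrum (𝓞 K), BorelSpace (v.adicCompletion K)] in
/-- the local character in `psiSqPi` form: `ψ_v(η_v Σ dᵢ zᵢ²) = psiSqPi ψ_v (η_v • d) z`. [folklore] -/
private theorem adicComponent_mul_sum_sq_eq_psiSqPi (d : ι → K) (v : HeightOneSpectrum (𝓞 K))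
    (ηv : v.adicCompletion K) (z : ι → v.adicCompletion K) :
    (((adeleAddChar K).adicComponent v (ηv * ∑ i, (d i : v.adicCompletion K) * z i ^ 2) : Circle) : ℂ) =
      psiSqPi ((adeleAddChar K).adicComponent v) (fun i => ηv * (d i : v.adicCompletion K)) z := by
  rw [psiSqPi_apply, Finset.mul_sum]
  congr 3
  funext i
  ring

omit [∀ v : HeightOneSpectrum (𝓞 K), MeasurableSpace (v.adicCompletion K)]
  [∀ v : HeightOneSpectrum (𝓞 K), BorelSpace (v.adicCompletion K)] in
/-- a `v`-unit is `v`-integral. [folklore] -/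
private theorem mem_adicCompletionIntegers_of_normAbs_eq_one {v : HeightOneSpectrum (𝓞 K)} {x : v.adicCompletion K}
    (hx : normAbs (v.adicCompletion K) x = 1) : x ∈ v.adicCompletionIntegers K := by
  rw [← mem_primePowBall_zero_iff, mem_primePowBall_iff, zpow_zero]
  exact hx.le

omit [∀ v : HeightOneSpectrum (𝓞 K), MeasurableSpace (v.adicCompletion K)]
  [∀ v : HeightOneSpectrum (𝓞 K), BorelSpace (v.adicCompletion K)] in
/-- at a place where `η_v` and the `dᵢ` are integral, the local character factor is `1` on integral points (Tate's `ψ_v`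
is trivial on `𝒪_v` at EVERY place, ★ `adicComponent_adeleAddChar_eq_one`). [cite: TateThesis1967, Lemma 3.2.1] -/
private theorem adicComponent_mul_sum_sq_eq_one {d : ι → K} {v : HeightOneSpectrum (𝓞 K)}
    (hdv : ∀ i, normAbs (v.adicCompletion K) (d i : v.adicCompletion K) = 1) {ηv : v.adicCompletion K}
    (hη : ηv ∈ v.adicCompletionIntegers K) {z : ι → v.adicCompletion K} (hz : ∀ i, z i ∈ v.adicCompletionIntegers K) :
    (adeleAddChar K).adicComponent v (ηv * ∑ i, (d i : v.adicCompletion K) * z i ^ 2) = 1 :=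
  adicComponent_adeleAddChar_eq_one ((mem_primePowBall_zero_iff _).2
    (mul_mem hη (sum_mem fun i _ => mul_mem (mem_adicCompletionIntegers_of_normAbs_eq_one K (hdv i)) (pow_mem (hz i) 2))))

omit [∀ v : HeightOneSpectrum (𝓞 K), MeasurableSpace (v.adicCompletion K)]
  [∀ v : HeightOneSpectrum (𝓞 K), BorelSpace (v.adicCompletion K)] in
/-- **THE INTEGRAND OF A PURE TENSOR IS A FINITE PRODUCT OFF A BOX**: for a pure tensor `Φ = ∏_v Φ_v` with `Φ_v = 𝟙_{𝒪_v^ι}`,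
`ψ_v` unramified-data off `T` and `η` integral off `T`,
`Φ(b) ψ_f(η Σ dᵢ bᵢ²) = 𝟙_{offBox T}(b) · ∏_{v ∈ T} Φ_v(b_v) ψ_v(η_v Σ dᵢ b_{i,v}²)`. [cite: TateThesis1967, Thm 3.3.1, Lemma 3.2.1] -/
theorem piProd_mul_finiteAdeleAddChar_eq_indicator (Φ : LocalSBFamily K ι) {d : ι → K} (η : FiniteAdeleRing (𝓞 K) K)
    (T : Finset (HeightOneSpectrum (𝓞 K))) (hΦ : ∀ v ∉ T, Φ v = unitVec K ι v)
    (hd : ∀ v ∉ T, ∀ i, normAbs (v.adicCompletion K) (d i : v.adicCompletion K) = 1)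
    (hη : ∀ v ∉ T, η v ∈ v.adicCompletionIntegers K) (b : ι → FiniteAdeleRing (𝓞 K) K) :
    piProd K ι Φ b * (finiteAdeleAddChar K (η * ∑ i, algebraMap K (FiniteAdeleRing (𝓞 K) K) (d i) * b i ^ 2) : ℂ) =
      (offBox T).indicator (fun b => ∏ v ∈ T,
        ((Φ v : (ι → v.adicCompletion K) → ℂ) (fun i => b i v) *
          psiSqPi ((adeleAddChar K).adicComponent v) (fun i => η v * (d i : v.adicCompletion K)) (fun i => b i v))) b := by
  by_cases hb : b ∈ offBox T
  · rw [Set.indicator_of_mem hb, Finset.prod_mul_distrib, piProd_eq_prod Φ b T hΦ fun v hv i => hb i v hv]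
    congr 1
    rw [finiteAdeleAddChar_apply, map_zero_prod_eq_finprod_adicComponent (continuous_adeleAddChar K) _,
      finprod_eq_prod_of_mulSupport_subset _ (s := T) ?_]
    · rw [show ((∏ v ∈ T, (adeleAddChar K).adicComponent v
          ((η * ∑ i, algebraMap K (FiniteAdeleRing (𝓞 K) K) (d i) * b i ^ 2) v) : Circle) : ℂ) =
          ∏ v ∈ T, (((adeleAddChar K).adicComponent v
            ((η * ∑ i, algebraMap K (FiniteAdeleRing (𝓞 K) K) (d i) * b i ^ 2) v) : Circle) : ℂ) from
        map_prod Circle.coeHom _ _]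
      refine Finset.prod_congr rfl fun v _ => ?_
      rw [apply_mul_sum_sq, adicComponent_mul_sum_sq_eq_psiSqPi]
    · intro v hv
      by_contra hvT
      rw [Finset.mem_coe] at hvT
      apply hv
      change (adeleAddChar K).adicComponent v ((η * ∑ i, algebraMap K (FiniteAdeleRing (𝓞 K) K) (d i) * b i ^ 2) v) = 1
      rw [apply_mul_sum_sq]
      exact adicComponent_mul_sum_sq_eq_one K ι (hd v hvT) (hη v hvT) fun i => hb i v hvT
  · rw [Set.indicator_of_notMem hb, piProd_eq_indicator Φ T hΦ, Set.indicator_of_notMem hb, zero_mul]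

variable [MeasurableSpace (FiniteAdeleRing (𝓞 K) K)] [BorelSpace (FiniteAdeleRing (𝓞 K) K)]

/-- **THE BOUND FOR A PURE TENSOR**: for `Φ = ∏_v Φ_v` there is `C ≥ 0` with
`‖∫ Φ(b) ψ_f(η Σ dᵢ bᵢ²) dμ‖ ≤ C · (∏_v max(1, |η_v|_v))^{-r/2}` for every finite adele `η`: Tate's Theorem 3.3.1
(★ `integral_indicator_offBox_prod_eq`) on the finite product of §3, the bad factors by ★ Weil's local decay, the good ones EXACT.
[cite: Weil1965, Chap. I n° 2 Prop. 2, p. 8; n° 40 Thm. 1, p. 57] [cite: TateThesis1967, Thm 3.3.1] -/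
theorem exists_norm_integral_piProd_mul_finiteAdeleAddChar_le (μ : Measure (ι → FiniteAdeleRing (𝓞 K) K))
    [μ.IsAddHaarMeasure] {d : ι → K} (hd : ∀ i, d i ≠ 0) (Φ : LocalSBFamily K ι) :
    ∃ C : ℝ, 0 ≤ C ∧ ∀ η : FiniteAdeleRing (𝓞 K) K,
      ‖∫ b, piProd K ι Φ b *
          (finiteAdeleAddChar K (η * ∑ i, algebraMap K (FiniteAdeleRing (𝓞 K) K) (d i) * b i ^ 2) : ℂ) ∂μ‖ ≤
        C * (((∏ᶠ v, max 1 (normAbs (v.adicCompletion K) (η v)) : ℝ≥0) : ℝ) ^ (-((Fintype.card ι : ℝ) / 2))) := by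
  classical
  haveI : ∀ v : HeightOneSpectrum (𝓞 K), SecondCountableTopology (v.adicCompletion K) := fun v =>
    secondCountableTopology_adicCompletion K v
  -- local Haar measures and their boxes
  set μv : ∀ v : HeightOneSpectrum (𝓞 K), Measure (v.adicCompletion K) := fun v => Measure.addHaar with hμv
  set ν : ∀ v : HeightOneSpectrum (𝓞 K), Measure (ι → v.adicCompletion K) := fun v => Measure.pi fun _ : ι => μv v
    with hν
  haveI hνHaar : ∀ v : HeightOneSpectrum (𝓞 K), (ν v).IsAddHaarMeasure := fun v => by
    simp only [hν]
    infer_instance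
  have hO_pos : ∀ v, 0 < μv v (primePowBall (v.adicCompletion K) 0) := fun v =>
    (isOpen_primePowBall (F := v.adicCompletion K) 0).measure_pos _ ⟨0, zero_mem_primePowBall 0⟩
  have hO_lt : ∀ v, μv v (primePowBall (v.adicCompletion K) 0) < ∞ := fun v =>
    (isCompact_primePowBall (F := v.adicCompletion K) 0).measure_lt_top
  have hνbox : ∀ v, ν v (integralBox K ι v) = μv v (primePowBall (v.adicCompletion K) 0) ^ Fintype.card ι := fun v =>
    pi_integralBox_eq_pow K ι v (μv v)
  have hνbox_real : ∀ v, (ν v (integralBox K ι v)).toReal = (μv v).real (primePowBall (v.adicCompletion K) 0) ^ Fintype.card ι :=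
    fun v => by rw [hνbox, ENNReal.toReal_pow]; rfl
  have hνbox_pos : ∀ v, 0 < (ν v (integralBox K ι v)).toReal := fun v => by
    rw [hνbox_real]
    exact pow_pos (ENNReal.toReal_pos (hO_pos v).ne' (hO_lt v).ne) _
  -- the bad places
  have hgood := eventually_good K ι hd Φ
  rw [eventually_cofinite] at hgood
  set S₀ : Finset (HeightOneSpectrum (𝓞 K)) := hgood.toFinset with hS₀
  have hS₀ : ∀ v ∉ S₀, ((adeleAddChar K).adicComponent v).HasConductorExp 0 ∧
      normAbs (v.adicCompletion K) (2 : v.adicCompletion K) = 1 ∧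
        (∀ i, normAbs (v.adicCompletion K) (d i : v.adicCompletion K) = 1) ∧ Φ v = unitVec K ι v := fun v hv => by
    by_contra h
    exact hv (hgood.mem_toFinset.2 h)
  -- the local constants at the bad places
  choose C hC0 hC using fun v : HeightOneSpectrum (𝓞 K) =>
    exists_norm_integral_mul_psiSqPi_adic_le K ι v (μv v) hd (Φ v).2
  set D : HeightOneSpectrum (𝓞 K) → ℝ := fun v => max 1 ((ν v (integralBox K ι v)).toReal⁻¹ * C v) with hD
  have hD1 : ∀ v, 1 ≤ D v := fun v => le_max_left _ _
  set C₀ : ℝ := (μ (offBox (ι := ι) ∅)).toReal * ∏ v ∈ S₀, D v with hC₀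
  have hC₀0 : 0 ≤ C₀ := mul_nonneg ENNReal.toReal_nonneg (Finset.prod_nonneg fun v _ => le_trans zero_le_one (hD1 v))
  refine ⟨C₀, hC₀0, fun η => ?_⟩
  -- the exceptional set of `η`
  have hηfin : {v : HeightOneSpectrum (𝓞 K) | η v ∉ v.adicCompletionIntegers K}.Finite := by
    have h : ∀ᶠ v : HeightOneSpectrum (𝓞 K) in cofinite, η v ∈ v.adicCompletionIntegers K := η.2
    rwa [eventually_cofinite] at h
  set T : Finset (HeightOneSpectrum (𝓞 K)) := S₀ ∪ hηfin.toFinset with hT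
  have hS₀T : S₀ ⊆ T := Finset.subset_union_left
  have hTgood : ∀ v ∉ T, v ∉ S₀ := fun v hv hvS => hv (hS₀T hvS)
  have hηT : ∀ v ∉ T, η v ∈ v.adicCompletionIntegers K := fun v hv => by
    by_contra h
    exact hv (Finset.mem_union_right _ (hηfin.mem_toFinset.2 h))
  -- the local integrands
  set F : ∀ v : HeightOneSpectrum (𝓞 K), (ι → v.adicCompletion K) → ℂ := fun v z =>
    (Φ v : (ι → v.adicCompletion K) → ℂ) z *
      psiSqPi ((adeleAddChar K).adicComponent v) (fun i => η v * (d i : v.adicCompletion K)) z with hF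
  have hFcont : ∀ v ∈ T, Continuous (F v) := fun v _ =>
    (mem_schwartzBruhat_iff.mp (Φ v).2).1.continuous.mul (continuous_psiSqPi_adic K ι v _)
  have hintegrand : (fun b : ι → FiniteAdeleRing (𝓞 K) K => piProd K ι Φ b *
      (finiteAdeleAddChar K (η * ∑ i, algebraMap K (FiniteAdeleRing (𝓞 K) K) (d i) * b i ^ 2) : ℂ)) =
      fun b => (offBox T).indicator (fun b => ∏ v ∈ T, F v fun i => b i v) b := by
    funext b
    exact piProd_mul_finiteAdeleAddChar_eq_indicator K ι Φ η T (fun v hv => (hS₀ v (hTgood v hv)).2.2.2)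
      (fun v hv => (hS₀ v (hTgood v hv)).2.2.1) hηT b
  rw [hintegrand, integral_indicator_offBox_prod_eq K ι μ ν T F hFcont]
  -- the local bounds, place by place
  set m : HeightOneSpectrum (𝓞 K) → ℝ := fun v => ((max 1 (normAbs (v.adicCompletion K) (η v)) : ℝ≥0) : ℝ) with hm
  have hm0 : ∀ v, 0 ≤ m v := fun v => NNReal.coe_nonneg _
  have hmr0 : ∀ v, 0 ≤ m v ^ (-((Fintype.card ι : ℝ) / 2)) := fun v => Real.rpow_nonneg (hm0 v) _
  set E : HeightOneSpectrum (𝓞 K) → ℝ := fun v => if v ∈ S₀ then D v else 1 with hE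
  have hE0 : ∀ v, 0 ≤ E v := fun v => by
    simp only [hE]
    split_ifs
    · exact le_trans zero_le_one (hD1 v)
    · exact zero_le_one
  have hlocal : ∀ v ∈ T, ‖(ν v (integralBox K ι v)).toReal⁻¹ • ∫ z, F v z ∂ν v‖ ≤ E v * m v ^ (-((Fintype.card ι : ℝ) / 2)) := by
    intro v _
    rw [norm_smul, norm_inv, Real.norm_of_nonneg (hνbox_pos v).le]
    by_cases hvS : v ∈ S₀
    · simp only [hE, if_pos hvS]
      calc (ν v (integralBox K ι v)).toReal⁻¹ * ‖∫ z, F v z ∂ν v‖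
          ≤ (ν v (integralBox K ι v)).toReal⁻¹ * (C v * m v ^ (-((Fintype.card ι : ℝ) / 2))) :=
            mul_le_mul_of_nonneg_left (hC v (η v)) (inv_nonneg.2 (hνbox_pos v).le)
        _ = ((ν v (integralBox K ι v)).toReal⁻¹ * C v) * m v ^ (-((Fintype.card ι : ℝ) / 2)) := by ring
        _ ≤ D v * m v ^ (-((Fintype.card ι : ℝ) / 2)) := mul_le_mul_of_nonneg_right (le_max_right _ _) (hmr0 v)
    · obtain ⟨hψ0, h2, hdv, hΦv⟩ := hS₀ v hvS
      simp only [hE, if_neg hvS, one_mul]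
      have hexact : ‖∫ z, F v z ∂ν v‖ = (μv v).real (primePowBall (v.adicCompletion K) 0) ^ Fintype.card ι *
          m v ^ (-((Fintype.card ι : ℝ) / 2)) := by
        simp only [hF, hν, hΦv]
        exact norm_integral_unitVec_mul_psiSqPi_adic_eq K ι v (μv v) hψ0 h2 hdv (η v)
      rw [hexact, hνbox_real, ← mul_assoc, inv_mul_cancel₀ (by rw [← hνbox_real]; exact (hνbox_pos v).ne'), one_mul]
  -- assemble
  have hprodE : ∏ v ∈ T, E v = ∏ v ∈ S₀, D v := by
    rw [← Finset.prod_subset hS₀T (f := E) fun v _ hvS => by simp only [hE, if_neg hvS]]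
    exact Finset.prod_congr rfl fun v hv => by simp only [hE, if_pos hv]
  have hprodm : ∏ v ∈ T, m v = (((∏ᶠ v, max 1 (normAbs (v.adicCompletion K) (η v)) : ℝ≥0) : ℝ)) := by
    rw [finprod_eq_prod_of_mulSupport_subset _ (s := T) ?_, NNReal.coe_prod]
    intro v hv
    by_contra hvT
    rw [Finset.mem_coe] at hvT
    apply hv
    have hle : normAbs (v.adicCompletion K) (η v) ≤ 1 := by
      have h := (mem_primePowBall_zero_iff (η v)).2 (hηT v hvT)
      rw [mem_primePowBall_iff, zpow_zero] at h
      exact h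
    exact max_eq_left hle
  calc ‖(μ (offBox (ι := ι) ∅)).toReal • ∏ v ∈ T, ((ν v (integralBox K ι v)).toReal⁻¹ • ∫ z, F v z ∂ν v)‖
      = (μ (offBox (ι := ι) ∅)).toReal * ∏ v ∈ T, ‖(ν v (integralBox K ι v)).toReal⁻¹ • ∫ z, F v z ∂ν v‖ := by
        rw [norm_smul, Real.norm_of_nonneg ENNReal.toReal_nonneg, norm_prod]
    _ ≤ (μ (offBox (ι := ι) ∅)).toReal * ∏ v ∈ T, (E v * m v ^ (-((Fintype.card ι : ℝ) / 2))) :=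
        mul_le_mul_of_nonneg_left (Finset.prod_le_prod (fun v _ => norm_nonneg _) hlocal) ENNReal.toReal_nonneg
    _ = C₀ * (((∏ᶠ v, max 1 (normAbs (v.adicCompletion K) (η v)) : ℝ≥0) : ℝ) ^ (-((Fintype.card ι : ℝ) / 2))) := by
        rw [Finset.prod_mul_distrib, hprodE, Real.finsetProd_rpow _ _ (fun v _ => hm0 v), hprodm, hC₀, mul_assoc]

end PureTensor

/-! ## §4 Every Schwartz–Bruhat function on `(𝔸_{K,f})^ι` -/

section General

variable [MeasurableSpace (FiniteAdeleRing (𝓞 K) K)] [BorelSpace (FiniteAdeleRing (𝓞 K) K)]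

omit [∀ v : HeightOneSpectrum (𝓞 K), MeasurableSpace (v.adicCompletion K)]
  [∀ v : HeightOneSpectrum (𝓞 K), BorelSpace (v.adicCompletion K)] in
/-- the character factor `b ↦ ψ_f(η Σ dᵢ bᵢ²)` is continuous and unimodular, so a Schwartz–Bruhat `Φ` times it is integrable.
[folklore] -/
private theorem integrable_mul_finiteAdeleAddChar_sum_sq (μ : Measure (ι → FiniteAdeleRing (𝓞 K) K))
    [μ.IsAddHaarMeasure] (d : ι → K) (η : FiniteAdeleRing (𝓞 K) K) {Φ : (ι → FiniteAdeleRing (𝓞 K) K) → ℂ}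
    (hΦ : Φ ∈ SchwartzBruhat (ι → FiniteAdeleRing (𝓞 K) K)) :
    Integrable (fun b => Φ b *
      (finiteAdeleAddChar K (η * ∑ i, algebraMap K (FiniteAdeleRing (𝓞 K) K) (d i) * b i ^ 2) : ℂ)) μ := by
  haveI : SecondCountableTopology (FiniteAdeleRing (𝓞 K) K) := secondCountableTopology_finiteAdeleRing K
  haveI : BorelSpace (ι → FiniteAdeleRing (𝓞 K) K) := Pi.borelSpace
  have hcont : Continuous fun b : ι → FiniteAdeleRing (𝓞 K) K =>
      (finiteAdeleAddChar K (η * ∑ i, algebraMap K (FiniteAdeleRing (𝓞 K) K) (d i) * b i ^ 2) : ℂ) :=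
    continuous_subtype_val.comp ((continuous_finiteAdeleAddChar K).comp (continuous_const.mul
      (continuous_finsetSum _ fun i _ => continuous_const.mul ((continuous_apply i).pow 2))))
  exact (integrable_of_mem_schwartzBruhat K μ hΦ).mul_bdd hcont.aestronglyMeasurable
    (Eventually.of_forall fun b => (Circle.norm_coe _).le)

/-- **DECAY OF THE FINITE-ADELIC GAUSS TRANSFORM**: for non-zero rational `dᵢ`, a Haar measure `μ` on `(𝔸_{K,f})^ι` and a
Schwartz–Bruhat `Φ` there is `C ≥ 0` with, for EVERY finite adele `η`,
`‖∫ Φ(b) ψ_f(η Σ dᵢ bᵢ²) dμ(b)‖ ≤ C · (∏_v max(1, |η_v|_v))^{-r/2}` (`r = |ι|`) — pure tensors span (★ `mem_span_range_piProd`) and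
§3. [cite: Weil1965, Chap. I n° 2 Prop. 2, p. 8; n° 40 Thm. 1, p. 57] [cite: TateThesis1967, Thm 3.3.1] -/
theorem exists_norm_integral_mul_finiteAdeleAddChar_sum_sq_le (μ : Measure (ι → FiniteAdeleRing (𝓞 K) K))
    [μ.IsAddHaarMeasure] {d : ι → K} (hd : ∀ i, d i ≠ 0) {Φ : (ι → FiniteAdeleRing (𝓞 K) K) → ℂ}
    (hΦ : Φ ∈ SchwartzBruhat (ι → FiniteAdeleRing (𝓞 K) K)) :
    ∃ C : ℝ, 0 ≤ C ∧ ∀ η : FiniteAdeleRing (𝓞 K) K,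
      ‖∫ b, Φ b * (finiteAdeleAddChar K (η * ∑ i, algebraMap K (FiniteAdeleRing (𝓞 K) K) (d i) * b i ^ 2) : ℂ) ∂μ‖ ≤
        C * (((∏ᶠ v, max 1 (normAbs (v.adicCompletion K) (η v)) : ℝ≥0) : ℝ) ^ (-((Fintype.card ι : ℝ) / 2))) := by
  have hspan := mem_span_range_piProd K ι hΦ
  clear hΦ
  induction hspan using Submodule.span_induction with
  | mem Ψ hΨ =>
    obtain ⟨Φfam, rfl⟩ := hΨ
    exact exists_norm_integral_piProd_mul_finiteAdeleAddChar_le K ι μ hd Φfam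
  | zero =>
    refine ⟨0, le_rfl, fun η => ?_⟩
    simp only [Pi.zero_apply, zero_mul, integral_zero, norm_zero, le_refl]
  | add Ψ₁ Ψ₂ hΨ₁ hΨ₂ h₁ h₂ =>
    obtain ⟨C₁, hC₁0, hC₁⟩ := h₁
    obtain ⟨C₂, hC₂0, hC₂⟩ := h₂
    refine ⟨C₁ + C₂, add_nonneg hC₁0 hC₂0, fun η => ?_⟩
    have hΨ₁' : Ψ₁ ∈ SchwartzBruhat (ι → FiniteAdeleRing (𝓞 K) K) := by rwa [← span_range_piProd_eq]
    have hΨ₂' : Ψ₂ ∈ SchwartzBruhat (ι → FiniteAdeleRing (𝓞 K) K) := by rwa [← span_range_piProd_eq]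
    have hi₁ := integrable_mul_finiteAdeleAddChar_sum_sq K ι μ d η hΨ₁'
    have hi₂ := integrable_mul_finiteAdeleAddChar_sum_sq K ι μ d η hΨ₂'
    simp only [Pi.add_apply, add_mul]
    rw [integral_add hi₁ hi₂]
    exact (norm_add_le _ _).trans (add_le_add (hC₁ η) (hC₂ η))
  | smul c Ψ hΨ h =>
    obtain ⟨C, hC0, hC⟩ := h
    refine ⟨‖c‖ * C, mul_nonneg (norm_nonneg _) hC0, fun η => ?_⟩
    simp only [Pi.smul_apply, smul_eq_mul, mul_assoc]
    rw [integral_const_mul, norm_mul]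
    exact mul_le_mul_of_nonneg_left (hC η) (norm_nonneg _)

end General


end Literature.NumberTheory.Weil1965

end
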